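import Summits.HodgeConjecture.HodgeCM.PerL34.FockHermite_2

/-! PORT of `HodgeCM/PerL34/FockHermite.lean` (HodgeCMPerL run 82) — part 3: continuation of `Summits.HodgeConjecture.HodgeCM.PerL34.FockHermite_2` (split at a top-level declaration boundary by port_pkg.py; scope re-opened below; declarations unchanged). -/

-- port_pkg: scope re-opened for this part (file-level context, then the namespace/section stack open at the cut)
set_option autoImplicit false
open MvPolynomial Complex
open scoped Real
namespace HodgeCM.PerL34.Fock.Hermite
noncomputable section
variable {σ : Type*}
section Triangular
variable [Fintype σ] [DecidableEq σ]
omit [DecidableEq σ] in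
/-- (Ported verbatim from the HodgeCMPerL package; no docstring in the source.) -/
theorem mdeg_eq_zero_iff (α : σ →₀ ℕ) : mdeg α = 0 ↔ α = 0 := by
  constructor
  · intro h
    ext j
    have := (Finset.sum_eq_zero_iff.mp h) j (Finset.mem_univ j)
    simpa using this
  · rintro rfl
    simp [mdeg]

/-- **[Fo89 §1.7 (ii); chunk p0046 L39–L41], triangularity**: `(z^α)(Z^*) h_0 = 2^{n/4} 2^{|α|} x^α + (terms of total degree < |α|)`. -/
theorem binv_monomial_triangular (α : σ →₀ ℕ) :
    binv (monomial α 1) - ((vacCoef σ : ℂ) * 2 ^ mdeg α) • monomial α 1 ∈ degLT (mdeg α) := by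
  suffices h : ∀ (n : ℕ) (α : σ →₀ ℕ), mdeg α = n →
      binv (monomial α 1) - ((vacCoef σ : ℂ) * 2 ^ n) • monomial α 1 ∈ degLT n from h _ α rfl
  intro n
  induction n with
  | zero =>
      intro α hα
      rw [mdeg_eq_zero_iff] at hα
      subst hα
      have h0 : binv (monomial (0 : σ →₀ ℕ) 1) - ((vacCoef σ : ℂ) * 2 ^ 0) • monomial (0 : σ →₀ ℕ) 1 = 0 := by
        rw [show (monomial (0 : σ →₀ ℕ) (1 : ℂ) : MvPolynomial σ ℂ) = 1 from rfl, binv_one, vac, pow_zero,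
          mul_one, sub_eq_zero, smul_eq_C_mul, mul_one]
      rw [h0]
      exact Submodule.zero_mem _
  | succ n ih =>
      intro α hα
      obtain ⟨j, hj⟩ : ∃ j, α j ≠ 0 := by
        by_contra hcon
        push Not at hcon
        have : mdeg α = 0 := Finset.sum_eq_zero fun j _ => hcon j
        omega
      have hle : Finsupp.single j 1 ≤ α := Finsupp.single_le_iff.mpr (Nat.one_le_iff_ne_zero.mpr hj)
      have hαβ : α = (α - Finsupp.single j 1) + Finsupp.single j 1 := (tsub_add_cancel_of_le hle).symm
      set β := α - Finsupp.single j 1 with hβdef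
      have hβn : mdeg β = n := by
        have := mdeg_add_single β j
        rw [← hαβ, hα] at this
        omega
      have ihβ := ih β hβn
      set r := binv (monomial β 1) - ((vacCoef σ : ℂ) * 2 ^ n) • monomial β 1 with hr
      have hsplit : binv (monomial β 1) = ((vacCoef σ : ℂ) * 2 ^ n) • monomial β 1 + r := by
        rw [hr]; abel
      have h1 : opZs j r ∈ degLT (n + 1) := opZs_mem_degLT j ihβ
      have h2 : (monomial (β - Finsupp.single j 1) ((β j : ℕ) : ℂ) : MvPolynomial σ ℂ) ∈ degLT (n + 1) :=
        monomial_mem_degLT _ (by have := mdeg_tsub_le β j; omega)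
      rw [hαβ, ← X_mul_monomial_one, binv_X_mul, hsplit, map_add, map_smul, opZs_apply, X_mul_monomial_one,
        pderiv_monomial, one_mul]
      convert Submodule.add_mem _ (Submodule.smul_mem _ (-((vacCoef σ : ℂ) * 2 ^ n * (2 * π : ℂ)⁻¹)) h2) h1
        using 1
      module

/-- The diagonal coefficient: `coeff_α ((z^α)(Z^*) h_0) = 2^{n/4} 2^{|α|} ≠ 0`. -/
theorem coeff_binv_monomial_self (α : σ →₀ ℕ) :
    coeff α (binv (monomial α 1)) = (vacCoef σ : ℂ) * 2 ^ mdeg α := by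
  have h := mem_degLT.mp (binv_monomial_triangular α)
  have hα : α ∉ (binv (monomial α 1) - ((vacCoef σ : ℂ) * 2 ^ mdeg α) • monomial α 1).support :=
    fun hmem => lt_irrefl _ (h α hmem)
  rw [notMem_support_iff, coeff_sub, coeff_smul, coeff_monomial, if_pos rfl, smul_eq_mul, mul_one,
    sub_eq_zero] at hα
  exact hα

/-- (Ported verbatim from the HodgeCMPerL package; no docstring in the source.) -/
theorem coeff_binv_monomial_of_ne {α γ : σ →₀ ℕ} (hne : γ ≠ α) (hdeg : mdeg α ≤ mdeg γ) :
    coeff γ (binv (monomial α 1)) = 0 := by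
  have h := mem_degLT.mp (binv_monomial_triangular α)
  have hγ : γ ∉ (binv (monomial α 1) - ((vacCoef σ : ℂ) * 2 ^ mdeg α) • monomial α 1).support :=
    fun hmem => absurd (h γ hmem) (not_lt.mpr hdeg)
  rw [notMem_support_iff, coeff_sub, coeff_smul, coeff_monomial, if_neg (Ne.symm hne), smul_zero,
    sub_zero] at hγ
  exact hγ

omit [Fintype σ] [DecidableEq σ] in
/-- (Ported verbatim from the HodgeCMPerL package; no docstring in the source.) -/
theorem monomial_eq_smul (α : σ →₀ ℕ) (c : ℂ) : (monomial α c : MvPolynomial σ ℂ) = c • monomial α 1 := by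
  rw [smul_monomial, smul_eq_mul, mul_one]

/-- **`B⁻¹` is injective on polynomials** (the CCR module `ℂ[z_σ]` is faithfully realised on the Hermite span). -/
theorem binv_injective : Function.Injective (binv (σ := σ)) := by
  rw [← LinearMap.ker_eq_bot, Submodule.eq_bot_iff]
  intro F hF
  rw [LinearMap.mem_ker] at hF
  by_contra hne
  have hS : F.support.Nonempty := by
    rw [Finset.nonempty_iff_ne_empty, Ne, support_eq_empty]
    exact hne
  obtain ⟨α₀, hα₀S, hmax⟩ := Finset.exists_max_image F.support mdeg hS
  have key : coeff α₀ (binv F) = coeff α₀ F * ((vacCoef σ : ℂ) * 2 ^ mdeg α₀) := by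
    conv_lhs => rw [F.as_sum]
    rw [map_sum, coeff_sum, Finset.sum_eq_single α₀]
    · rw [monomial_eq_smul, map_smul, coeff_smul, coeff_binv_monomial_self, smul_eq_mul]
    · intro α hα hne'
      rw [monomial_eq_smul, map_smul, coeff_smul, coeff_binv_monomial_of_ne (Ne.symm hne') (hmax α hα),
        smul_zero]
    · intro h
      exact absurd hα₀S h
  rw [hF, coeff_zero] at key
  have hc : ((vacCoef σ : ℂ) * 2 ^ mdeg α₀) ≠ 0 :=
    mul_ne_zero (Complex.ofReal_ne_zero.mpr vacCoef_pos.ne') (pow_ne_zero _ two_ne_zero)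
  exact (mem_support_iff.mp hα₀S) ((mul_eq_zero.mp key.symm).resolve_right hc)

/-- `x_j = (Z_j + Z_j^*)/2` transported: `x_j · B⁻¹F = ½ (B⁻¹(z_j F) + π⁻¹ B⁻¹(∂_j F))`. -/
theorem X_mul_binv (j : σ) (F : MvPolynomial σ ℂ) :
    X j * binv F = (2 : ℂ)⁻¹ • (binv (X j * F) + (π : ℂ)⁻¹ • binv (pderiv j F)) := by
  rw [binv_X_mul, ← opZ_binv, opZs_apply, opZ_apply]
  module

/-- **`B⁻¹` is surjective onto the polynomial symbols**: every `p(x) e^{−πx²}` is a finite combination of Hermite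
functions (Folland (1.81)(iii)). -/
theorem binv_surjective : Function.Surjective (binv (σ := σ)) := by
  suffices hrange : ∀ p : MvPolynomial σ ℂ, p ∈ LinearMap.range (binv (σ := σ)) from
    fun p => by obtain ⟨F, hF⟩ := hrange p; exact ⟨F, hF⟩
  intro p
  induction p using MvPolynomial.induction_on with
  | C a =>
      refine ⟨C (a * ((vacCoef σ : ℂ))⁻¹), ?_⟩
      have hc : (vacCoef σ : ℂ) ≠ 0 := Complex.ofReal_ne_zero.mpr vacCoef_pos.ne'
      rw [binv_C, vac, smul_eq_C_mul, ← map_mul]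
      congr 1
      field_simp
  | add p q hp hq => exact Submodule.add_mem _ hp hq
  | mul_X p j hp =>
      obtain ⟨F, hF⟩ := hp
      rw [mul_comm, ← hF, X_mul_binv]
      exact Submodule.smul_mem _ _ (Submodule.add_mem _ ⟨_, rfl⟩ (Submodule.smul_mem _ _ ⟨_, rfl⟩))

/-- **The polynomial-level (inverse) Bargmann transform as a linear isomorphism `ℂ[z_σ] ≃ ℂ[x_σ]`**
(symbols of the Hermite span); Folland §1.6, with `h_α = B⁻¹ ζ_α` (§1.7, first line). -/
def bargmannInv : MvPolynomial σ ℂ ≃ₗ[ℂ] MvPolynomial σ ℂ :=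
  LinearEquiv.ofBijective binv ⟨binv_injective, binv_surjective⟩

/-- (Ported verbatim from the HodgeCMPerL package; no docstring in the source.) -/
@[simp] theorem bargmannInv_apply (F : MvPolynomial σ ℂ) : bargmannInv F = binv F := rfl

/-- **[Fo89 §1.7 (ii); chunk p0046 L41] "`H_α(x) = 2^{(n/4)+|α|} √(π^{|α|}/α!) x^α + (terms of degree < |α|)`"**
(KERNEL; "degree" = total degree, `degLT`). -/
theorem herm_leading (α : σ →₀ ℕ) :
    herm α - ((vacCoef σ * 2 ^ mdeg α * hcoef α : ℝ) : ℂ) • monomial α 1 ∈ degLT (mdeg α) := by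
  have h := Submodule.smul_mem _ (hcoef α : ℂ) (binv_monomial_triangular α)
  rw [herm_eq]
  convert h using 1
  push_cast
  module

/-- The Hermite functions are linearly independent (indeed `α ↦ h_α` composes the basis `z^α` with the isomorphism
`B⁻¹` and the non-zero scalars `√(π^{|α|}/α!)`). -/
theorem herm_ne_zero (α : σ →₀ ℕ) : herm α ≠ 0 := by
  rw [herm_eq]
  refine smul_ne_zero (Complex.ofReal_ne_zero.mpr (hcoef_pos α).ne') ?_
  rw [Ne, ← map_zero binv, binv_injective.eq_iff]
  exact (monomial_eq_zero).not.mpr one_ne_zero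

end Triangular

section Quadratic

variable [Fintype σ] [DecidableEq σ]

/-! ### The quadratic letters: Adams's `𝔨, 𝔭⁺, 𝔭⁻` on `ℂ[z_σ]` versus Folland's (4.49) family on the Hermite span -/

/-- `𝔭⁺ ↦ z_i z_j` ([Ad07] chunk p0010) is carried by `B⁻¹` to `Z_i^* Z_j^*`. -/
theorem binv_zz (i j : σ) (F : MvPolynomial σ ℂ) :
    binv (X i * (X j * F)) = opZs i (opZs j (binv F)) := by
  rw [binv_X_mul, binv_X_mul]

/-- `𝔭⁻ ↦ ∂²/∂z_i∂z_j` is carried by `B⁻¹` to `π² Z_i Z_j`. -/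
theorem binv_dd (i j : σ) (F : MvPolynomial σ ℂ) :
    binv (pderiv i (pderiv j F)) = ((π : ℂ) ^ 2) • opZ i (opZ j (binv F)) := by
  have hπ := pi_ne_zero'
  rw [opZ_binv, map_smul, opZ_binv, smul_smul, smul_smul,
    show (π : ℂ) ^ 2 * (π : ℂ)⁻¹ * (π : ℂ)⁻¹ = 1 by field_simp, one_smul]

/-- `𝔨 ↦ z_i ∂/∂z_j + ½δ_{ij}` is carried by `B⁻¹` to `π Z_i^* Z_j + ½δ_{ij}`; for `i = j` this is one half of the
Hermite operator, `π Z_j^* Z_j + ½ = π(D_j² + X_j²)` by (1.80)(v). -/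
theorem binv_zd (i j : σ) (F : MvPolynomial σ ℂ) :
    binv (X i * pderiv j F + (1 / 2 : ℂ) • (if i = j then F else 0)) =
      (π : ℂ) • opZs i (opZ j (binv F)) + (1 / 2 : ℂ) • (if i = j then binv F else 0) := by
  have hπ := pi_ne_zero'
  rw [map_add, map_smul, binv_X_mul, opZ_binv, map_smul, smul_smul, mul_inv_cancel₀ hπ, one_smul]
  by_cases h : i = j
  · simp [h]
  · simp [h]

/-- The diagonal case made explicit: `B⁻¹ (z_j ∂_j + ½) B = ½ · 2π(D_j² + X_j²)` on the Hermite span. -/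
theorem binv_euler_half (j : σ) (F : MvPolynomial σ ℂ) :
    binv (X j * pderiv j F + (1 / 2 : ℂ) • F) = (1 / 2 : ℂ) • hermiteOp j (binv F) := by
  have h := binv_zd j j F
  rw [if_pos rfl, if_pos rfl] at h
  rw [h, hermiteOp_apply, smul_add, smul_smul]
  module

end Quadratic

end

end HodgeCM.PerL34.Fock.Hermite
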